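import Summits.ResolutionOfSingularities.ResolutionOfSingularities.Theorems.PurelyInseparableDim4ResConeCInfKillersPrime
import Summits.ResolutionOfSingularities.ResolutionOfSingularities.Theorems.PurelyInseparableDim4ResConeCInfTranslatedStepSigma
import HarnessLib
import HarnessLib.Audit.Tags

/-!
# Purely inseparable four-folds — KILLERS of the flagless branch, every σ = (n, n) + 0 and every prime: the `1 ↦ n` edition of FILE ♯3
# `…ResConeCInfKillersPrime` (cell `res-dim4-pi`, K2(p) lane, class (iii) rows σ = (n, n) + 0, flagless branch, FILE ♯3σ)

[OURS · counted 0 · cell `res-dim4-pi` · K2(p) lane (holder res-dim4-p-12 g5, ruling g5-33 «(σ♭)»; res-dim4-p-3 g6's MEMO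
`res-dim4-p-3/MEMO-g6-FLAGLESS-SHARP.md` (F3), (U♯) and σ-split (bus 2026-08-29 15:59Z); conventions of res-dim4-typ-1 g6 (bus 15:49Z);
typed by the width seat res-dim4-p-13 g6 by signature).]  Nothing here proves K2(p) for any `p`, any TAIL(p, d, 3), FLAGLESS♯,
`NoIsolatedTrap p p`, the Cossart–Jannsen–Saito theorem or resolution of singularities in dimension ≥ 4 / characteristic `p` — NOT proved.
AI kernel work, weaker than expert review.  Exponent algebra about OUR frame; it kills nothing by itself.

SETTING.  Twin slots `j, i` of weight `n ≥ 1`, free letter `u`, contact letter `f`; `n + d = p`, `2 ≤ d`; F-exponents `(e_j, e_i, e_u, e_f)`;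
σ-LEDGER «`e_f ≤ d − 1 ⇒ e_j, e_i ≥ n + 1`»; σ-FLAG row `x_j^{n+1} x_i^{n+1} x_u^{d−1−c} x_f^{c}` (`c + 2 ≤ d`); the σ-`κ`-KILLERS are the other
members of the σ-flag's `κ`-line: `x_j^{a+1} x_i^{n+1} x_u^{d+n−1−c−a} x_f^{c}`, `n + 1 ≤ a ≤ d + n − 1 − c` (degree `p + n + 1`); the σ-♯-flag of
regime R is `x_j^{n+2} x_i^{n+2} x_u^{d−2}`.  For `n = 1` (`d + 1 = p`) every statement below is literally the corresponding statement of
FILE ♯3, whose weight-free §1 `coeff_top_step_translate_u` (the TOP of a line is carried by every translated slot step) is used by name;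
the σ-flag invariance is res-dim4-p-7 g6's ♯1σ `coeff_flag_step_translate_u_sigma`.
* §1 **`coeff_sharpFlag_step_translate_u_sigma`** (`3 ≤ d`) — in regime R («`e_f = 0 ⇒ e_j ≥ n + 2`») the σ-♯-flag coefficient is carried
  by the slot step in the chart of `j` translated by ANY `β·e_u`.
* §2 **`not_regime_step_translate_u_of_killer_sigma`** (MEMO (F3), σ-edition) — a σ-FLAGLESS σ-ledger state carrying a σ-`κ`-KILLER has
  NO in-regime `κ`-child for ANY translation `β` (in regime = every child monomial has degree `≥ p + n + 1` or is the cone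
  `x_j^n x_i^n x_f^d`): the killer's `κ`-line is the flag line, whose Hasse sums would all be child coefficients below degree `p + n + 1`
  or the (zero) σ-flag.
* §3 **`coeff_killer_step_translate_other_sigma`** — the same killer is CARRIED by every `o`-step (any `β′`): it is the top of its
  `o`-line by the σ-ledger.  So a σ-killer freezes the chart to `o` for ever.
[cite: Hauser2010, §§F–G] [cite: CossartJannsenSaito2020, Lemma 13.2, Thm. 3.14]
bears_on: LADDER-RESOLUTION:D157-DOOR2 (res-dim4-pi · K2(p) · power cones · class (iii) σ = (n,n)+0 flagless branch ♯3σ).  Supports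
stmt-ResolutionOfSingularities-16155 (helper).
-/

set_option linter.dupNamespace false -- mandated namespace of this single-conjunct summit

noncomputable section

namespace Summit.ResolutionOfSingularities.ResolutionOfSingularities.Theorems.PIDim4

namespace ResCone

open MvPolynomial Finset
open Literature.AlgebraicGeometry.Resolution
open Literature.AlgebraicGeometry.Resolution.CentreBlowup
open Literature.AlgebraicGeometry.Resolution.Hauser2010
open Literature.AlgebraicGeometry.Resolution.HauserPerlega2019

variable {K : Type} [Field K] [DecidableEq K]

section Step

variable {j i u f : Fin 4} (hji : j ≠ i) (hju : j ≠ u) (hjf : j ≠ f) (hiu : i ≠ u) (hif : i ≠ f) (huf : u ≠ f)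
include hji hju hjf hiu hif huf

/-! ## 1. The σ-♯-flag is carried in regime R -/

/-- **THE σ-♯-FLAG IS CARRIED in regime R** (`n + d = p`, `3 ≤ d`): if every `f`-free parent monomial has `e_j ≥ n + 2` (residual
`κ`-exponent `≥ 2`), the coefficient of `x_j^{n+2} x_i^{n+2} x_u^{d−2}` — the residual `κ²o²u^{d−2}` — is carried by the slot step in the
chart of `j` translated by ANY `β·e_u`. The `n = 1` case is FILE ♯3's `coeff_sharpFlag_step_translate_u`. [OURS] [cite: Hauser2010, §§F–G] -/
theorem coeff_sharpFlag_step_translate_u_sigma (p : ℕ) {n d : ℕ} (hσ : n + d = p) (hd3 : 3 ≤ d) (s : State K)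
    (hq : ((p : ℕ) : ℕ∞) ≤ ordAlong Finset.univ s.F) (hR : ∀ e ∈ s.F.support, e f = 0 → n + 2 ≤ e j) (β : K) :
    coeff (Finsupp.single j (n + 2) + Finsupp.single i (n + 2) + Finsupp.single u (d - 2) + Finsupp.single f 0)
        (CentreBlowup.step p Finset.univ j (Function.update (0 : Fin 4 → K) u β) s).F =
      coeff (Finsupp.single j (n + 2) + Finsupp.single i (n + 2) + Finsupp.single u (d - 2) + Finsupp.single f 0) s.F := by
  obtain ⟨h1, h2, h3, h4⟩ := quad_apply hji hju hjf hiu hif huf (n + 2) (n + 2) (d - 2) 0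
  refine coeff_top_step_translate_u hji hju hjf hiu hif huf p s hq β h1 (by rw [degree_quad]; omega) ?_ ?_
  · rw [isPthPowerExponent_iff]
    intro h
    have := Nat.le_of_dvd (by omega) (h2 ▸ h i)
    omega
  · intro δ hδ _ _ hf
    exact hR δ hδ (by rw [hf, h4])

/-! ## 2. A σ-`κ`-killer of a σ-flagless state forbids every `κ`-step -/

/-- **A σ-`κ`-KILLER FORBIDS EVERY `κ`-STEP** (MEMO (F3), σ-edition; `n + d = p`, `2 ≤ d`).  Parent `s`: order `≥ p`-along, σ-ledger,
σ-FLAGLESS at contact exponent `c` (`coeff x_j^{n+1} x_i^{n+1} x_u^{d−1−c} x_f^c = 0`, `c + 2 ≤ d`), carrying the σ-killer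
`x_j^{a+1} x_i^{n+1} x_u^{d+n−1−c−a} x_f^c` (`n + 1 ≤ a ≤ d + n − 1 − c`).  Then for EVERY `β` the child of the slot step in the chart of `j`
translated by `β·e_u` is NOT in regime: some child monomial of degree `< p + n + 1` other than the cone `x_j^n x_i^n x_f^d` survives. The
`n = 1` case is FILE ♯3's `not_regime_step_translate_u_of_killer`. [OURS] [cite: Hauser2010, §§F–G] [cite: CossartJannsenSaito2020, Thm. 3.14] -/
theorem not_regime_step_translate_u_of_killer_sigma (p : ℕ) {n d : ℕ} (hσ : n + d = p) (hd2 : 2 ≤ d) (s : State K)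
    (hq : ((p : ℕ) : ℕ∞) ≤ ordAlong Finset.univ s.F)
    (hled : ∀ e ∈ s.F.support, e f ≤ d - 1 → n + 1 ≤ e j ∧ n + 1 ≤ e i) {a c : ℕ} (hna : n + 1 ≤ a)
    (hac : a ≤ d + n - 1 - c) (hc : c + 2 ≤ d)
    (hflag : coeff (Finsupp.single j (n + 1) + Finsupp.single i (n + 1) + Finsupp.single u (d - 1 - c) + Finsupp.single f c)
      s.F = 0)
    (hkill : coeff (Finsupp.single j (a + 1) + Finsupp.single i (n + 1) + Finsupp.single u (d + n - 1 - c - a) +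
      Finsupp.single f c) s.F ≠ 0)
    (β : K) :
    ¬ (∀ E ∈ (CentreBlowup.step p Finset.univ j (Function.update (0 : Fin 4 → K) u β) s).F.support,
        p + n + 1 ≤ E.degree ∨ E = Finsupp.single j n + Finsupp.single i n + Finsupp.single u 0 + Finsupp.single f d) := by
  classical
  intro hreg
  set s₁ := CentreBlowup.step p Finset.univ j (Function.update (0 : Fin 4 → K) u β) s with hs₁
  obtain ⟨hKj, hKi, hKu, hKf⟩ := quad_apply hji hju hjf hiu hif huf (a + 1) (n + 1) (d + n - 1 - c - a) c
  -- the `κ`-line of the killer: `|δ| = p + n + 1`, `δ_i = n + 1`, `δ_f = c`; members have `δ_j ≥ n + 1`, so `δ_u ≤ d − 1 − c`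
  have htop : ∀ δ ∈ s.F.support, δ.degree = p + n + 1 → δ i = n + 1 → δ f = c → δ u ≤ d - 1 - c := by
    intro δ hδ hm hi hf
    have h2 := (hled δ hδ (by omega)).1
    have := degree_eq_quad hji hju hjf hiu hif huf δ
    omega
  have hvan : ∀ J, J ≤ d - 1 - c →
      ∑ δ ∈ s.F.support with (δ.degree = p + n + 1 ∧ δ i = n + 1 ∧ δ f = c),
        ((δ u).choose J : K) * β ^ (δ u - J) * coeff δ s.F = 0 := by
    intro J hJ
    set γ : Fin 4 →₀ ℕ := Finsupp.single i (n + 1) + Finsupp.single u J + Finsupp.single f c with hγ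
    have hγj : γ j = 0 := by
      rw [hγ, Finsupp.add_apply, Finsupp.add_apply, Finsupp.single_eq_of_ne hji, Finsupp.single_eq_of_ne hju,
        Finsupp.single_eq_of_ne hjf]; simp
    have hγi : γ i = n + 1 := by
      rw [hγ, Finsupp.add_apply, Finsupp.add_apply, Finsupp.single_eq_same, Finsupp.single_eq_of_ne hiu,
        Finsupp.single_eq_of_ne hif]; simp
    have hγu : γ u = J := by
      rw [hγ, Finsupp.add_apply, Finsupp.add_apply, Finsupp.single_eq_of_ne hiu.symm, Finsupp.single_eq_same,
        Finsupp.single_eq_of_ne huf]; simp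
    have hγf : γ f = c := by
      rw [hγ, Finsupp.add_apply, Finsupp.add_apply, Finsupp.single_eq_of_ne hif.symm, Finsupp.single_eq_of_ne huf.symm,
        Finsupp.single_eq_same]; simp
    have hnp : ¬ IsPthPowerExponent p (γ + Finsupp.single j (p + n + 1 - p)) := by
      rw [isPthPowerExponent_iff]
      intro h
      have h2 := h j
      rw [Finsupp.add_apply, hγj, zero_add, Finsupp.single_eq_same, show p + n + 1 - p = n + 1 by omega] at h2
      have := Nat.le_of_dvd (by omega) h2
      omega
    have key := coeff_step_translate_u hji hju hjf hiu hif huf p s hq β (show p ≤ p + n + 1 by omega) γ hγj hnp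
    simp only [hγi, hγu, hγf] at key
    rw [← key]
    rcases Nat.lt_or_ge J (d - 1 - c) with hlt | hge
    · -- below degree `p + n + 1` and not the cone: absent from the in-regime child
      refine notMem_support_iff.mp fun hmem₁ => ?_
      rcases hreg _ hmem₁ with hge | hcone
      · have hdegγ : (γ + Finsupp.single j (p + n + 1 - p)).degree = n + 1 + J + c + (p + n + 1 - p) := by
          rw [map_add, Finsupp.degree_single, hγ, map_add, map_add, Finsupp.degree_single, Finsupp.degree_single,
            Finsupp.degree_single]
        rw [hdegγ] at hge
        omega
      · have hj2 : (γ + Finsupp.single j (p + n + 1 - p)) j =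
            (Finsupp.single j n + Finsupp.single i n + Finsupp.single u 0 + Finsupp.single f d : Fin 4 →₀ ℕ) j := by
          rw [hcone]
        rw [Finsupp.add_apply, hγj, Finsupp.single_eq_same, (quad_apply hji hju hjf hiu hif huf n n 0 d).1] at hj2
        omega
    · -- the top sum is the child's σ-flag, equal to the parent's σ-flag, which is zero
      have hJ' : J = d - 1 - c := le_antisymm hJ hge
      have hexp : γ + Finsupp.single j (p + n + 1 - p) =
          Finsupp.single j (n + 1) + Finsupp.single i (n + 1) + Finsupp.single u (d - 1 - c) + Finsupp.single f c := by
        rw [show p + n + 1 - p = n + 1 by omega, hγ, hJ']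
        abel
      rw [hexp, coeff_flag_step_translate_u_sigma hji hju hjf hiu hif huf p hσ hd2 s hq (fun e he hef => (hled e he hef).1) β hc,
        hflag]
  have hzero := line_eq_zero_of_hasse_vanish hji hju hjf hiu hif huf s.F (p + n + 1) (n + 1) c β (d - 1 - c) htop hvan
    (Finsupp.single j (a + 1) + Finsupp.single i (n + 1) + Finsupp.single u (d + n - 1 - c - a) + Finsupp.single f c)
    (by rw [degree_quad]; omega) hKi hKf
  exact hkill hzero

/-! ## 3. A σ-`κ`-killer survives every `o`-step -/

/-- **A σ-`κ`-KILLER SURVIVES EVERY `o`-STEP** (`n + d = p`, `2 ≤ d`): with the σ-ledger, the coefficient of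
`x_j^{a+1} x_i^{n+1} x_u^{d+n−1−c−a} x_f^c` (`a ≤ d + n − 1 − c`, `c + 1 ≤ d`) is carried by the slot step in the chart of the OTHER slot `i`
translated by ANY `β′·e_u` (it is the top of its `o`-line).  With §2: once a σ-`κ`-killer is born the chain takes the chart `o` for ever.
The `n = 1` case is FILE ♯3's `coeff_killer_step_translate_other`. [OURS] [cite: Hauser2010, §§F–G] -/
theorem coeff_killer_step_translate_other_sigma (p : ℕ) {n d : ℕ} (hσ : n + d = p) (hd2 : 2 ≤ d) (s : State K)
    (hq : ((p : ℕ) : ℕ∞) ≤ ordAlong Finset.univ s.F) (hled : ∀ e ∈ s.F.support, e f ≤ d - 1 → n + 1 ≤ e j ∧ n + 1 ≤ e i)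
    {a c : ℕ} (hac : a ≤ d + n - 1 - c) (hc : c + 1 ≤ d) (β' : K) :
    coeff (Finsupp.single j (a + 1) + Finsupp.single i (n + 1) + Finsupp.single u (d + n - 1 - c - a) + Finsupp.single f c)
        (CentreBlowup.step p Finset.univ i (Function.update (0 : Fin 4 → K) u β') s).F =
      coeff (Finsupp.single j (a + 1) + Finsupp.single i (n + 1) + Finsupp.single u (d + n - 1 - c - a) + Finsupp.single f c)
        s.F := by
  obtain ⟨hKj, hKi, hKu, hKf⟩ := quad_apply hji hju hjf hiu hif huf (a + 1) (n + 1) (d + n - 1 - c - a) c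
  refine coeff_top_step_translate_u hji.symm hiu hif hju hjf huf p s hq β' hKi (by rw [degree_quad]; omega) ?_ ?_
  · rw [isPthPowerExponent_iff]
    intro h
    have := Nat.le_of_dvd (by omega) (hKi ▸ h i)
    omega
  · intro δ hδ _ _ hf
    exact (hled δ hδ (by rw [hf, hKf]; omega)).2

end Step

end ResCone

end Summit.ResolutionOfSingularities.ResolutionOfSingularities.Theorems.PIDim4
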